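import Summits.AtomisticToContinuum.HydrodynamicLimit.Theorems.RelayRaceLocalityNearConstantShortTimeHLTiltL2Assembly
import Summits.AtomisticToContinuum.HydrodynamicLimit.Theorems.RelayRaceLocalityNearConstantShortTimeHLReductionTL
import Summits.AtomisticToContinuum.HydrodynamicLimit.Theorems.RelayRaceLocalityNearConstantShortTimeHLDynamicTL
import HarnessLib

/-!
# Crux `NearConstantShortTimeHL` (stmt-AtomisticToContinuum-12502), line `small-tilt-domination`, skeleton v25 "TL" (lead c10):
# the ENDGAME WITH CLOSURE INPUTS ALONG THE TRUE LAW — the crux from local equilibrium of the fluxes in probability, the packing cap and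
# super-exponential velocity tails, with NO equilibrium import

Support file (`--supports stmt-AtomisticToContinuum-12502`). Composition of the landed pieces of skeleton v25: level 0 `stub_reductionTL` (`…ReductionTL`,
p166205) ∘ level 1 `stub_dynamicTL` (`…DynamicTL`, p165692, over `stub_goodEventPackageTL` p165153) through the means-pin dock and the entropy-to-LLN step,
with the statics side of the line closed (`…TiltL2Assembly`). WHY v25: skeletons v13–v24 typed the closure inputs as EQUILIBRIUM large-deviation bounds
("K-stubs") imported along the true law through the tilt domination `P_N ≤ e^{Cδ₀n} G_N`; the import forces a rate uniform in the defect threshold (a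
super-exponential one-block estimate), priced physics-false for the energy row under every velocity cap by leads c7/c9 (needle beams, Newton cradles,
train cradles). v25 drops the import and the near-constancy lever altogether and takes the two closure inputs ALONG THE TRUE LAW as convergence in
probability (`TrueLawMomentumClosure`, `TrueLawEnergyClosure`, `…TrueLawClosureDefs` p164768: the one-block / local-equilibrium input of Yau 1991 §2 and
Olla–Varadhan–Yau 1993 §1, §4 — a theorem there thanks to the noise, for deterministic hard spheres the open "derivation of local equilibrium"). Net
effect: `TrueLawMomentumClosure → TrueLawEnergyClosure → TrueLawCapsPE → NearConstantShortTimeHL`, kernel-checked — the hard-sphere Euler limit before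
shocks follows from local equilibrium of the momentum and energy fluxes in probability plus the ball-packing cap and super-exponential velocity tails in
mean along the true law; everything else (statics of general families, the Dafermos relative-entropy algebra for the hard-sphere Euler system with its
virial equation of state, the good-event Grönwall, entropy → LLN) is proved in the tree.
References: H.-T. Yau, Lett. Math. Phys. 22 (1991) §2; S. Olla – S.R.S. Varadhan – H.-T. Yau, Comm. Math. Phys. 155 (1993) §1, §4; C. Kipnis – C. Landim
(1999) Ch. 6.
-/

noncomputable section

namespace Summit.AtomisticToContinuum.HydrodynamicLimit.Theorems.NearConstantShortTimeHL

open Summit.AtomisticToContinuum.HydrodynamicLimit.Theses.RelayRaceLocality (NearConstantShortTimeHL)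

/-- **THE CRUX FROM ITS FOUR INPUTS, TRUE-LAW CLOSURE** (endgame of skeleton v25): the mesoscale static superlinearity St2′, momentum / energy closure
in probability along the true law (S2ᵀ, S3ᵀ), and the packing cap plus all exponential velocity moments in mean along the true law (S4‴). No
`TiltDomination`, no equilibrium K-stub. [cite: Yau1991, §2] [cite: OllaVaradhanYau1993, §1] -/
theorem nearConstantShortTimeHL_of_inputsTL : MesoscaleSuperlinearityE → TrueLawMomentumClosure → TrueLawEnergyClosure → TrueLawCapsPE → NearConstantShortTimeHL :=
  fun hSt2 hS2 hS3 hS4 =>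
    stub_entropyToLLN (stub_meansToRelEntropy (meansConverge_of_nearConstantRelEntropy
      (stub_meansPin stub_ldaGeneralFamilies stub_concentrationGeneralFamilies
        (stub_reductionTL stub_dynamicTL hSt2 stub_uniformPressure stub_staticLLN hS2 hS3 hS4))))

/-- **THE CRUX FROM THE THREE TRUE-LAW CONJECTURES ALONE.** With the statics side of the line closed, the hydrodynamic-limit crux
`NearConstantShortTimeHL` follows from local equilibrium of the momentum and energy fluxes IN PROBABILITY ALONG THE TRUE LAW (S2ᵀ, S3ᵀ) and, along the
true law, the ball-packing cap and super-exponential velocity tails in mean (S4‴) — no equilibrium large-deviation rate, no import, no use of the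
near-constancy of the data. [cite: Yau1991, §2] [cite: OllaVaradhanYau1993, §1, §4] -/
theorem nearConstantShortTimeHL_of_dynamicsTL :
    TrueLawMomentumClosure → TrueLawEnergyClosure → TrueLawCapsPE → NearConstantShortTimeHL :=
  nearConstantShortTimeHL_of_inputsTL
    (mesoscaleSuperlinearityE_of (positionMesoscaleLD_of_densityLD mesoscaleDensityLD_holds) (stub_velocityLD stub_ballGaussianEstimate))

end Summit.AtomisticToContinuum.HydrodynamicLimit.Theorems.NearConstantShortTimeHL

end
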